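import Summits.ResolutionOfSingularities.ResolutionOfSingularities.Theorems.WeightedInvariantKeyRungThreeClosures
import Summits.ResolutionOfSingularities.ResolutionOfSingularities.Theorems.WeightedInvariantIotaFlatTTorusFactorDoor
import Summits.ResolutionOfSingularities.ResolutionOfSingularities.Theorems.WeightedInvariantIota3TauDescentAdm
import HarnessLib

/-!
# (c10)≤3 `IotaTorusFactorMonotoneLE 3 p ι₃ᵗ` CLOSED BY NAME; the graded HOM rung for `(ι₃ᵗ, J₃ᵗ)` needs (desc-τ) only through (c11)≤3
# (door `HypersurfaceCentreConstruction`, stmt-ResolutionOfSingularities-19897)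

Helper for `stub_keyRungGrHomLE_three` (def-free, `--supports 19897`).  The clause (c10)≤3 is DOOR-typed (`S` essentially of finite type over a
perfect field), and (desc-τ) holds in the door setting unconditionally (`Iota3.isTiePosition_descent_door`, hand -4).  Reading the τ-inputs of
`iotaFlatT_torusFactorMonotoneLE_of_door` in the door setting (`iotaTau_essSmooth_eq_door`, `iotaTau_torusFactor_le_door`,
`iotaOrdEpsTau_torusFactor_le_door`, `iotaOrdEpsTau_genericFibre_eq_door` — proofs of the `…OfTauEssSmooth` lemmas verbatim, with (c11τ)≤3 applied at
localisations `S_𝔭`, which stay in the door setting) and the σ-input from (σ-ext) (`sigmaExt_holds`, …KeyRungThreeClosures) gives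
**`Iota3.iotaFlatT_torusFactorMonotoneLE_three : IotaTorusFactorMonotoneLE 3 p iotaFlatT`** unconditionally, and
**`pRungGrHomLE_three_of_c11_game`**: `PRungGrHomLE 3 p iotaFlatT jFlatT` from (c11)≤3 `IotaJEssSmoothCompatibleLE 3 iotaFlatT jFlatT` (the only
clause still typed over ALL regular local rings; door-provable, typing item) and hgame.
[OURS · L1 W4.3; AI work, weaker than expert review; nothing here is a statement of the manuscript under review.]
-/

noncomputable section

open IsLocalRing Literature.AlgebraicGeometry.Resolution Polynomial
open Summit.ResolutionOfSingularities.ResolutionOfSingularities.Theorems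
open Summit.ResolutionOfSingularities.ResolutionOfSingularities.Theorems.ContactCylinder

set_option linter.dupNamespace false -- mandated namespace of this single-conjunct summit

namespace Summit.ResolutionOfSingularities.ResolutionOfSingularities.Cruxes.HypersurfaceCentreConstruction.LocalEngine

namespace Iota3

/-- **(c11τ)≤3 IN THE DOOR SETTING, UNCONDITIONAL**: `τ(S', φ f) = τ(S, f)` for `S` regular local essentially of finite type over a field and
`φ : S → S'` local, formally smooth, essentially of finite type, `dim S' ≤ 3` (ascent `iotaTau_le_iotaTau_map_of_essSmooth`, descent
`isTiePosition_descent_door`). [OURS · (c11τ)≤3, door] -/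
theorem iotaTau_essSmooth_eq_door (k₀ : Type) [Field k₀] (S S' : Type) [CommRing S] [IsRegularLocalRing S] [CommRing S']
    [IsRegularLocalRing S'] [Algebra k₀ S] [Algebra.EssFiniteType k₀ S] [Algebra S S'] [IsLocalHom (algebraMap S S')]
    [Algebra.FormallySmooth S S'] [Algebra.EssFiniteType S S'] (f : S) (hdimS' : ringKrullDim S' ≤ 3) :
    iotaTau S' (algebraMap S S' f) = iotaTau S f := by
  refine le_antisymm ?_ (iotaTau_le_iotaTau_map_of_essSmooth S S' hdimS' f)
  rcases iotaTau_eq_zero_or_eq_one S' (algebraMap S S' f) with h0 | h1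
  · rw [h0]; exact zero_le
  · have htie' : IsTiePosition S' (algebraMap S S' f) := (iotaTau_eq_one_iff_isTiePosition hdimS' _).mp h1
    rw [h1, iotaTau_of_isTiePosition (isTiePosition_descent_door S S' k₀ hdimS' htie')]

/-- **τ does not increase along `S → S[X]_𝔮` — DOOR SETTING, UNCONDITIONAL** (`S` regular local essentially of finite type over a field):
`τ(S[X]_𝔮, g) ≤ τ(S, g)` for every prime `𝔮 ⊂ S[X]` (proof of `iotaTau_torusFactor_le_of_tauEssSmooth` with (c11τ)≤3 read in the door
setting at `S_𝔭 → S_𝔭[X]_{𝔮₁}`). [OURS · (c10τ), door] -/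
theorem iotaTau_torusFactor_le_door (k₀ : Type) [Field k₀] (S : Type) [CommRing S] [IsRegularLocalRing S] [Algebra k₀ S]
    [Algebra.EssFiniteType k₀ S] (f : S) (𝔮 : Ideal S[X]) [𝔮.IsPrime] :
    iotaTau (Localization.AtPrime 𝔮) (algebraMap S[X] (Localization.AtPrime 𝔮) (C f)) ≤ iotaTau S f := by
  rcases iotaTau_eq_zero_or_eq_one (Localization.AtPrime 𝔮) (algebraMap S[X] (Localization.AtPrime 𝔮) (C f)) with h0 | h1
  · rw [h0]; exact zero_le
  rw [h1]
  -- a tie generisation `(S[X]_𝔮)_𝔔`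
  obtain ⟨𝔔, htie⟩ := (iotaTau_eq_one_iff_exists _ _).mp h1
  have hdim𝔔 : ringKrullDim (Localization.AtPrime 𝔔.asIdeal) = 3 := ringKrullDim_eq_three_of_isTiePosition htie
  have hτ𝔔 : iotaTau (Localization.AtPrime 𝔔.asIdeal) (algebraMap (Localization.AtPrime 𝔮) (Localization.AtPrime 𝔔.asIdeal)
      (algebraMap S[X] (Localization.AtPrime 𝔮) (C f))) = 1 := iotaTau_of_isTiePosition htie
  -- read on `S[X]_Q`, `Q = 𝔔 ∩ S[X]`
  obtain ⟨Q, hQ⟩ : ∃ Q : Ideal S[X], Q = 𝔔.asIdeal.comap (algebraMap S[X] (Localization.AtPrime 𝔮)) := ⟨_, rfl⟩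
  haveI hQp : Q.IsPrime := by rw [hQ]; infer_instance
  have hτQ : iotaTau (Localization.AtPrime Q) (algebraMap S[X] (Localization.AtPrime Q) (C f)) = 1 := by
    rw [← hτ𝔔, StratumIff.iota_localization_localization_eq iotaTau iotaTau_isoInvariant 𝔮 𝔔.asIdeal (C f)]
    exact StratumIff.iota_localization_congr iotaTau hQ (C f)
  have hdimQ : ringKrullDim (Localization.AtPrime Q) = 3 := by
    have e := (IsLocalization.localizationLocalizationAtPrimeIsoLocalization 𝔮.primeCompl 𝔔.asIdeal).toRingEquiv
    have h := ringKrullDim_eq_of_ringEquiv e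
    rw [hdim𝔔] at h
    rw [TieFinite.ringKrullDim_atPrime_congr hQ, ← h]
  -- read on `S_𝔭[X]_{𝔮₁}`, `𝔭 = Q ∩ S`
  obtain ⟨𝔮₁, h𝔮₁p, h𝔮₁, -, Φ, hΦ⟩ := exists_ringEquiv_atPrime_polynomial S f Q (Q.comap (C : S →+* S[X])) rfl
  haveI := h𝔮₁p
  have hτ₁ : iotaTau (Localization.AtPrime 𝔮₁) (algebraMap (Localization.AtPrime (Q.comap (C : S →+* S[X])))[X]
      (Localization.AtPrime 𝔮₁) (C (algebraMap S (Localization.AtPrime (Q.comap (C : S →+* S[X]))) f))) = 1 := by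
    rw [← hΦ, iota_ringEquiv_atPrime Q 𝔮₁ iotaTau_isoInvariant Φ, hτQ]
  have hdim₁ : ringKrullDim (Localization.AtPrime 𝔮₁) ≤ 3 := by
    rw [← ringKrullDim_eq_of_ringEquiv Φ, hdimQ]
  -- (c11τ)≤3 along `S_𝔭 → S_𝔭[X]_{𝔮₁}`
  set S𝔭 := Localization.AtPrime (Q.comap (C : S →+* S[X])) with hS𝔭
  haveI : IsRegularLocalRing S𝔭 := isRegularLocalRing_localization_atPrime S _
  haveI := isRegularLocalRing_localization_polynomial S𝔭 𝔮₁
  haveI := isLocalHom_algebraMap_localization_polynomial S𝔭 𝔮₁ h𝔮₁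
  haveI := formallySmooth_localization_polynomial S𝔭 𝔮₁
  haveI := essFiniteType_localization_polynomial S𝔭 𝔮₁
  haveI : Algebra.EssFiniteType k₀ S𝔭 := Algebra.EssFiniteType.comp k₀ S S𝔭
  have hτ𝔭 : iotaTau S𝔭 (algebraMap S S𝔭 f) = 1 := by
    rw [← iotaTau_essSmooth_eq_door k₀ S𝔭 (Localization.AtPrime 𝔮₁) (algebraMap S S𝔭 f) hdim₁,
      IsScalarTower.algebraMap_apply S𝔭 S𝔭[X] (Localization.AtPrime 𝔮₁), Polynomial.algebraMap_eq, hτ₁]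
  -- (c7τ): `τ(S_𝔭) ≤ τ(S)`
  rw [← hτ𝔭]
  exact iotaTau_localization_le _ f


/-- `ι₀(S[X]_𝔮, g) ≤ ι₀(S, g)` for `𝔮` over `𝔪_S` — DOOR SETTING, UNCONDITIONAL. [OURS · (c10) for ι₀, door] -/
theorem iotaOrdEpsTau_torusFactor_le_door (k₀ : Type) [Field k₀] (S : Type) [CommRing S] [IsRegularLocalRing S] [Algebra k₀ S]
    [Algebra.EssFiniteType k₀ S] (f : S)
    (𝔮 : Ideal S[X]) [𝔮.IsPrime] (_hdim : ringKrullDim S ≤ 3) (h𝔮 : 𝔮.comap (C : S →+* S[X]) = maximalIdeal S) :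
    iotaOrdEpsTau (Localization.AtPrime 𝔮) (algebraMap S[X] (Localization.AtPrime 𝔮) (C f)) ≤ iotaOrdEpsTau S f := by
  rw [iotaOrdEpsTau_le_iff]
  exact Or.inr ⟨iotaOrdEps_torusFactor_eq S 𝔮 h𝔮 f, iotaTau_torusFactor_le_door k₀ S f 𝔮⟩


/-- The generic-fibre equality `ι₀(S(X), g) = ι₀(S, g)` — DOOR SETTING, UNCONDITIONAL. [OURS · (c10) for ι₀, door] -/
theorem iotaOrdEpsTau_genericFibre_eq_door (k₀ : Type) [Field k₀] (S : Type) [CommRing S] [IsRegularLocalRing S] [Algebra k₀ S]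
    [Algebra.EssFiniteType k₀ S] (f : S)
    [((maximalIdeal S).map (C : S →+* S[X])).IsPrime] (hdim : ringKrullDim S ≤ 3) :
    iotaOrdEpsTau (Localization.AtPrime ((maximalIdeal S).map (C : S →+* S[X])))
        (algebraMap S[X] (Localization.AtPrime ((maximalIdeal S).map (C : S →+* S[X]))) (C f)) = iotaOrdEpsTau S f := by
  have h𝔮 : ((maximalIdeal S).map (C : S →+* S[X])).comap (C : S →+* S[X]) = maximalIdeal S :=
    ((maximalIdeal.isMaximal S).eq_of_le Ideal.IsPrime.ne_top' Ideal.le_comap_map).symm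
  -- `dim S(X) = dim S ≤ 3`
  have hdimX : ringKrullDim (Localization.AtPrime ((maximalIdeal S).map (C : S →+* S[X]))) ≤ 3 := by
    rw [IsLocalization.AtPrime.ringKrullDim_eq_height ((maximalIdeal S).map (C : S →+* S[X]))
      (Localization.AtPrime ((maximalIdeal S).map (C : S →+* S[X]))), Polynomial.height_map_C,
      IsLocalRing.maximalIdeal_height_eq_ringKrullDim]
    exact hdim
  haveI := isRegularLocalRing_localization_polynomial S ((maximalIdeal S).map (C : S →+* S[X]))
  haveI := isLocalHom_algebraMap_localization_polynomial S ((maximalIdeal S).map (C : S →+* S[X])) h𝔮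
  haveI := formallySmooth_localization_polynomial S ((maximalIdeal S).map (C : S →+* S[X]))
  haveI := essFiniteType_localization_polynomial S ((maximalIdeal S).map (C : S →+* S[X]))
  have hτX := iotaTau_essSmooth_eq_door k₀ S (Localization.AtPrime ((maximalIdeal S).map (C : S →+* S[X]))) f hdimX
  rw [IsScalarTower.algebraMap_apply S S[X] (Localization.AtPrime ((maximalIdeal S).map (C : S →+* S[X]))),
    Polynomial.algebraMap_eq] at hτX
  rw [iotaOrdEpsTau_eq_iff]
  exact ⟨iotaOrdEps_torusFactor_eq S _ h𝔮 f, hτX⟩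


/-- **(c10)≤3 FOR THE INVARIANT OF RECORD, UNCONDITIONAL**: `IotaTorusFactorMonotoneLE 3 p iotaFlatT` for every `p` (proof of
`iotaFlatT_torusFactorMonotoneLE_of_door` with `h10τ`/`hgenτ` read in the door setting — τ-descent `isTiePosition_descent_door` — and the σ
generic-fibre input from (σ-ext) `sigmaExt_holds`). [OURS · L1 W4.3 · (c10)≤3 closed by name] -/
theorem iotaFlatT_torusFactorMonotoneLE_three (p : ℕ) : IotaTorusFactorMonotoneLE 3 p iotaFlatT := by
  intro k₀ _ _ _ S _ _ _ _ f 𝔮 _ hdim h𝔮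
  haveI := isDomain_of_isRegularLocalRing S
  haveI : IsRegularRing S := isRegularRing_of_isRegularLocalRing S
  have hdimT : ∀ (𝔭 : Ideal S) [𝔭.IsPrime], ringKrullDim (Localization.AtPrime 𝔭) ≤ 3 := fun 𝔭 _ =>
    (ringKrullDim_localization_atPrime_le 𝔭).trans hdim
  have h10 : iotaOrdEpsTau (Localization.AtPrime 𝔮) (algebraMap S[X] (Localization.AtPrime 𝔮) (C f)) ≤
      iotaOrdEpsTau S f := iotaOrdEpsTau_torusFactor_le_door k₀ S f 𝔮 hdim h𝔮
  have hb : IotaBoundedBy ((Ordinal.omega0 + 1) * Ordinal.omega0) (iotaCylinder iotaOrdEpsTau iotaSigma) :=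
    iotaBoundedBy_iotaCylinder iotaSigma_boundedBy
  have key : ∀ (P : Ideal S) [P.IsPrime], topStratum iotaOrdEpsTau S f = {𝔮₀ | P ≤ 𝔮₀.asIdeal} →
      iotaFlatT (Localization.AtPrime 𝔮) (algebraMap S[X] (Localization.AtPrime 𝔮) (C f)) ≤ iotaFlatT S f := by
    intro P _ hE
    have hP𝔮 : P.map (C : S →+* S[X]) ≤ 𝔮 := by
      rw [Ideal.map_le_iff_le_comap, h𝔮]
      exact IsLocalRing.le_maximalIdeal (Ideal.IsPrime.ne_top ‹_›)
    -- the ONE use of `hσ`: at `S_P`, essentially of finite type over `k₀`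
    haveI : Algebra.EssFiniteType k₀ (Localization.AtPrime P) := Algebra.EssFiniteType.comp k₀ S (Localization.AtPrime P)
    have hσ' : iotaSigma (Localization.AtPrime (P.map (C : S →+* S[X]))) (algebraMap S[X] _ (C f)) ≤
        iotaSigma (Localization.AtPrime P) (algebraMap S (Localization.AtPrime P) f) := by
      obtain ⟨_, h1⟩ := iota_atPrime_map_C_eq_of_generic iotaSigma_isoInvariant S f P
      rw [h1]
      exact sigma_genericFibre_le_of_sigmaExt sigmaExt_holds (Localization.AtPrime P) (algebraMap S (Localization.AtPrime P) f) (hdimT P)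
    have hE' : iotaOrdEpsTau (Localization.AtPrime 𝔮) (algebraMap S[X] (Localization.AtPrime 𝔮) (C f)) =
        iotaOrdEpsTau S f →
        topStratum iotaOrdEpsTau (Localization.AtPrime 𝔮) (algebraMap S[X] (Localization.AtPrime 𝔮) (C f)) =
          {𝔮'' | (P.map (C : S →+* S[X])).map (algebraMap S[X] (Localization.AtPrime 𝔮)) ≤ 𝔮''.asIdeal} := by
      intro heq
      refine topStratum_torusFactor_of_eq iotaOrdEpsTau_isoInvariant S f P hE 𝔮 heq ?_ ?_ ?_ ?_ ?_
      · intro _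
        obtain ⟨_, h1⟩ := iota_atPrime_map_C_eq_of_generic iotaOrdEpsTau_isoInvariant S f P
        rw [h1]
        exact iotaOrdEpsTau_genericFibre_eq_door k₀ (Localization.AtPrime P) (algebraMap S (Localization.AtPrime P) f) (hdimT P)
      · intro 𝔮' _ h𝔮'
        exact iota_atPrime_le_of_le iotaOrdEpsTau_isoInvariant iotaOrdEpsTau_generizationMonotone S[X] 𝔮' 𝔮 h𝔮' (C f)
      · intro 𝔮' _ _ hle
        exact iota_atPrime_le_of_le iotaOrdEpsTau_isoInvariant iotaOrdEpsTau_generizationMonotone S[X] _ 𝔮' hle (C f)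
      · intro 𝔮' _ _
        obtain ⟨𝔮₁, h𝔮₁, hmax, -, Φ, hΦ⟩ :=
          exists_ringEquiv_atPrime_polynomial S f 𝔮' (𝔮'.comap (C : S →+* S[X])) rfl
        rw [← iota_ringEquiv_atPrime (𝔫 := 𝔮') (𝔫' := 𝔮₁) iotaOrdEpsTau_isoInvariant Φ, hΦ]
        haveI : Algebra.EssFiniteType k₀ (Localization.AtPrime (𝔮'.comap (C : S →+* S[X]))) :=
          Algebra.EssFiniteType.comp k₀ S (Localization.AtPrime (𝔮'.comap (C : S →+* S[X])))
        exact iotaOrdEpsTau_torusFactor_le_door k₀ (Localization.AtPrime (𝔮'.comap (C : S →+* S[X]))) _ 𝔮₁ (hdimT _) hmax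
      · intro 𝔭 _
        exact iotaOrdEpsTau_generizationMonotone S 𝔭 f
    unfold iotaFlatT
    exact iotaLex_iotaCylinder_torusFactor_le iotaSigma_isoInvariant hb S f P hE 𝔮 hP𝔮 h10 hE' hσ'
  by_cases hf0 : f = 0
  · subst hf0
    exact key ⊥ (topStratum_iotaOrdEpsTau_zero_eq_bot S hdim)
  by_cases hfu : IsUnit f
  · exact key ⊥ (topStratum_iotaOrdEpsTau_of_isUnit_eq_bot S hdim hfu)
  · have hf : f ∈ maximalIdeal S := (IsLocalRing.mem_maximalIdeal f).mpr (mem_nonunits_iff.mpr hfu)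
    obtain ⟨P, hP, -, -, hE⟩ := topStratum_iotaOrdEpsTau_eq hdim hf0 hf
    haveI := hP
    exact key P hE


end Iota3

open Iota3

/-- **THE GRADED HOM RUNG FOR THE NAMED PAIR FROM (c11)≤3 AND hgame**: `PRungGrHomLE 3 p iotaFlatT jFlatT` — every other clause is a tree theorem
((c10)≤3 now `iotaFlatT_torusFactorMonotoneLE_three`). [OURS · L1 W4.3 · audit glue] -/
theorem pRungGrHomLE_three_of_c11_game (p : ℕ) (hc11 : IotaJEssSmoothCompatibleLE 3 iotaFlatT jFlatT)
    (hgame : CanonicalGameClauseHomLE 3 p iotaFlatT jFlatT) : PRungGrHomLE 3 p iotaFlatT jFlatT :=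
  ⟨⟨iotaFlatT_isoInvariant, iotaFlatT_generizationMonotoneLE p, iotaFlatT_upperSemicontinuousLE_three p,
      iotaFlatT_torusFactorMonotoneLE_three p, jFlatT_isoInvariant, hc11, hgame,
      jOpenPresentationForallSingLE_three p, iotaFlatT_unitInvariant, jFlatT_unitInvariant⟩,
    iotaFlatT_upperSemicontinuousGradedLE_three p⟩

/-- **GAP LIST (registrar shape)**: `KeyRungGrHomLE 3 p` from (c11)≤3 and hgame. [OURS · L1 W4.3 · audit glue] -/
theorem keyRungGrHomLE_three_of_c11_game (p : ℕ) (hc11 : IotaJEssSmoothCompatibleLE 3 iotaFlatT jFlatT)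
    (hgame : CanonicalGameClauseHomLE 3 p iotaFlatT jFlatT) : KeyRungGrHomLE 3 p :=
  ⟨iotaFlatT, jFlatT, pRungGrHomLE_three_of_c11_game p hc11 hgame⟩

end Summit.ResolutionOfSingularities.ResolutionOfSingularities.Cruxes.HypersurfaceCentreConstruction.LocalEngine

end
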